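/-
COR-CM (cell pub-hodgecm2, stage 2 of the Hodge ladder) — count-neutral KERNEL COMBINATORICS «the sheared dihedral family», part III: the block count
(seat prover-pub-hodgecm2-b23-g52-0, binder prover b23, gen 52; claim «SYLOW TRANSFER XII + THE SHEARED DIHEDRAL FAMILY», HOME/INBOX.md l.23708).
Theorems only, on parts I–II (`Census/ShearedDihedralDatum.lean`, `Census/ShearedDihedralFloor.lean`) and seat b09ʼs Burnside count
(`BlockParity.card_block_mul_card`) BY NAME; no `decide` beyond closed numerals (divisor sets and totients of 4, 6, 8), no certificate, no named fact,
no `sorry`; `Interfaces.lean` (C1), every E term, B01, `Transposition/*`, `PortJoin/*`, `D2Bridge/*` untouched.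
HONEST FRAMING: `HC_CM` is NOT proved, here or anywhere in the tree; nothing here is a period, a count of record or a headline.
T5: n/a-class (hypothesis binders = the fields of `ShearedDihedral.Datum`; checker: self).
-/
import Summits.HodgeConjecture.CorCM.Census.ShearedDihedralFloor

/-!
# The sheared dihedral family, III: the block count `β(G_n) · 8n = Σ_{d ∣ 2n} φ(d)·τ_n(d) + 2n · 4ⁿ`

For a sheared dihedral datum `D` on `(G, c)` (`G ≅ G_n = ⟨g, s, x⟩`, `|G| = 8n`, `c = gⁿ`) seat b09ʼs Burnside count
`β·|G| = Σ_y [c ∉ ⟨y⟩]·2^{|G|/(2·ord y)}` is evaluated over the normal form `y = gⁱ sʲ xᵉ` of part I: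
* the `2n` involutions `gⁱ x` fix `2^{2n} = 4ⁿ` types each; the `2n` elements `gⁱ s x` have square `c` and fix nothing (§1);
* a rotation `gⁱ` of order `d` has `c ∈ ⟨gⁱ⟩ ⟺ d` even (`c` is the unique involution of `⟨g⟩`), contributing `[d odd]·2^{4n/d}`; the element
  `gⁱ s` has order `lcm(2, d)` and `c ∈ ⟨gⁱ s⟩ ⟺ 4 ∣ d`, contributing `[4 ∤ d]·2^{4n/lcm(2,d)}` (§1);
* counting the rotations of order `d ∣ 2n` by Eulerʼs `φ` (Mathlibʼs `IsCyclic.card_orderOf_eq_totient` in `⟨g⟩`):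
  **`card_block_mul_eq_sum_divisors`**: `β · 8n = Σ_{d ∣ 2n} φ(d)·([d odd]·2^{4n/d} + [4 ∤ d]·2^{4n/lcm(2,d)}) + 2n·4ⁿ` (§2)
  (equivalently `Σ_{d ∣ n, d odd} φ(d)(16^{n/d} + 2·4^{n/d}) + 2n·4ⁿ`);
* rows (§3): **`n = 2` (the Pauli group, order 16): `β = 22`**, **`n = 3` (`X₃ = ℤ/3 ⋊ D₄`, order 24): `β = 194`**, **`n = 4` (order 32): `β = 2128`**,
  and with part IIʼs floor every generating face family has at least `20`, `192`, `2126 = φ₂` members (the conjectured law is equality; gen 46ʼs atlas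
  and this seatʼs numerics give `μ = 20, 192, 2126`).

## References
* [Pohlmann1968] H. Pohlmann, Algebraic cycles on abelian varieties of complex multiplication type, Ann. of Math. 88 (1968), Thm 1.
* [Milne1999] J. S. Milne, Lefschetz motives and the Tate conjecture, Compositio Math. 117 (1999), Prop. 2.1, p. 54.
-/

namespace Summit.HodgeConjecture.CorCM.Census.ShearedDihedral

open Finset
open Summit.HodgeConjecture.CorCM.Prior.AllgGroup.RfwfAllgGroup
open Summit.HodgeConjecture.CorCM.Census.BlockParity
open Summit.HodgeConjecture.CorCM.Census.Coinvariant

noncomputable section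

variable {G : Type*} [Group G] [Fintype G] [DecidableEq G] {c : G} {n : ℕ}
variable (D : Datum G c n)

namespace Datum

include D

/-! ## §1 Orders and `c`-membership along the normal form -/

omit [DecidableEq G] in
/-- `n ≠ 0`. [folklore] -/
private theorem n_ne_zero : n ≠ 0 := by
  intro h
  have := D.card_eq_eight_mul
  rw [h, mul_zero] at this
  exact Fintype.card_ne_zero this

omit [Fintype G] [DecidableEq G] in
/-- `c ∈ ⟨g⟩`. [folklore] -/
private theorem c_mem_zpowers_g : c ∈ Subgroup.zpowers D.g := by
  have h : D.g ^ n ∈ Subgroup.zpowers D.g := Subgroup.pow_mem _ (Subgroup.mem_zpowers _) n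
  rwa [D.hgn] at h

omit [DecidableEq G] in
/-- An involution of `⟨g⟩` is `c`: `y ∈ ⟨g⟩`, `y² = 1`, `y ≠ 1 ⟹ y = c`. [folklore] -/
private theorem eq_c_of_mem_zpowers_of_mul_self {y : G} (hy : y ∈ Subgroup.zpowers D.g) (hy2 : y * y = 1) (hy1 : y ≠ 1) : y = c := by
  rw [← D.hgn]; exact IndexTwoCyclic.eq_pow_of_mem_zpowers_of_mul_self D.hord hy hy2 hy1

omit [DecidableEq G] in
/-- **`c ∈ ⟨gⁱ⟩ ⟺ ord gⁱ` is even.** [folklore] -/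
theorem c_mem_zpowers_pow_iff (i : ℕ) : c ∈ Subgroup.zpowers (D.g ^ i) ↔ Even (orderOf (D.g ^ i)) := by
  constructor
  · intro h
    have hd := orderOf_dvd_of_mem_zpowers h
    rw [orderOf_eq_prime (p := 2) (by rw [pow_two]; exact D.c_mul_c) D.c_ne_one] at hd
    exact even_iff_two_dvd.mpr hd
  · rintro ⟨k, hk⟩
    have hk2 : orderOf (D.g ^ i) = 2 * k := by omega
    have hkpos : 0 < k := by have := orderOf_pos (D.g ^ i); omega
    have hy : orderOf ((D.g ^ i) ^ k) = 2 := by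
      rw [orderOf_pow' _ hkpos.ne', hk2, Nat.gcd_mul_left_left, Nat.mul_div_cancel 2 hkpos]
    have hy2 : (D.g ^ i) ^ k * (D.g ^ i) ^ k = 1 := by rw [← pow_two, ← hy]; exact pow_orderOf_eq_one _
    have hy1 : (D.g ^ i) ^ k ≠ 1 := fun h => by rw [h, orderOf_one] at hy; exact absurd hy (by norm_num)
    have hmem : (D.g ^ i) ^ k ∈ Subgroup.zpowers D.g := by rw [← pow_mul]; exact Subgroup.pow_mem _ (Subgroup.mem_zpowers _) _
    have h := Subgroup.pow_mem (Subgroup.zpowers (D.g ^ i)) (Subgroup.mem_zpowers _) k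
    rwa [D.eq_c_of_mem_zpowers_of_mul_self hmem hy2 hy1] at h

omit [Fintype G] [DecidableEq G] in
/-- Powers of `gⁱ s`: `(gⁱ s)ᵏ = gⁱᵏ sᵏ`. [folklore] -/
theorem pow_mul_s_pow (i k : ℕ) : (D.g ^ i * D.s) ^ k = D.g ^ (i * k) * D.s ^ k := by
  rw [(D.commute_g_s.pow_left i).mul_pow, ← pow_mul]

omit [Fintype G] [DecidableEq G] in
/-- `gᵃ sᵏ ∈ ⟨g⟩` forces `k` even. [folklore] -/
theorem even_of_pow_mul_spow_mem {a k : ℕ} (h : D.g ^ a * D.s ^ k ∈ Subgroup.zpowers D.g) : Even k := by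
  by_contra hk
  rw [Nat.not_even_iff_odd] at hk
  obtain ⟨m, rfl⟩ := hk
  apply D.hs
  have e : D.s ^ (2 * m + 1) = D.s := by rw [pow_succ, pow_mul, pow_two, D.hs2, one_pow, one_mul]
  rw [e] at h
  simpa only [inv_mul_cancel_left] using Subgroup.mul_mem _ (Subgroup.inv_mem _ (Subgroup.pow_mem _ (Subgroup.mem_zpowers D.g) a)) h

omit [Fintype G] [DecidableEq G] in
/-- `(gⁱ s)ᵏ = 1 ⟺ 2 ∣ k ∧ ord gⁱ ∣ k`. [folklore] -/
theorem pow_mul_s_pow_eq_one_iff (i k : ℕ) : (D.g ^ i * D.s) ^ k = 1 ↔ 2 ∣ k ∧ orderOf (D.g ^ i) ∣ k := by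
  rw [D.pow_mul_s_pow]
  constructor
  · intro h
    have hmem : D.g ^ (i * k) * D.s ^ k ∈ Subgroup.zpowers D.g := by rw [h]; exact one_mem _
    have hk := D.even_of_pow_mul_spow_mem hmem
    refine ⟨even_iff_two_dvd.mp hk, ?_⟩
    obtain ⟨m, rfl⟩ := hk
    refine orderOf_dvd_of_pow_eq_one ?_
    rw [← two_mul] at h ⊢
    rw [pow_mul D.s, pow_two, D.hs2, one_pow, mul_one, pow_mul] at h
    exact h
  · rintro ⟨⟨m, rfl⟩, hd⟩
    rw [pow_mul, orderOf_dvd_iff_pow_eq_one.mp hd, pow_mul D.s, pow_two, D.hs2, one_pow, mul_one]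

omit [Fintype G] [DecidableEq G] in
/-- **`ord (gⁱ s) = lcm(2, ord gⁱ)`.** [folklore] -/
theorem orderOf_pow_mul_s (i : ℕ) : orderOf (D.g ^ i * D.s) = Nat.lcm 2 (orderOf (D.g ^ i)) := by
  apply Nat.dvd_antisymm
  · exact orderOf_dvd_of_pow_eq_one ((D.pow_mul_s_pow_eq_one_iff i _).mpr ⟨Nat.dvd_lcm_left _ _, Nat.dvd_lcm_right _ _⟩)
  · obtain ⟨h2, hd⟩ := (D.pow_mul_s_pow_eq_one_iff i _).mp (pow_orderOf_eq_one (D.g ^ i * D.s))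
    exact Nat.lcm_dvd h2 hd

omit [DecidableEq G] in
/-- **`c ∈ ⟨gⁱ s⟩ ⟺ 4 ∣ ord gⁱ`.** [folklore] -/
theorem c_mem_zpowers_pow_mul_s_iff (i : ℕ) : c ∈ Subgroup.zpowers (D.g ^ i * D.s) ↔ 4 ∣ orderOf (D.g ^ i) := by
  have key : c ∈ Subgroup.zpowers (D.g ^ i * D.s) ↔ c ∈ Subgroup.zpowers (D.g ^ (2 * i)) := by
    constructor
    · intro h
      obtain ⟨k, -, hk⟩ := IndexTwoCyclic.exists_pow_eq_of_mem_zpowers h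
      rw [D.pow_mul_s_pow] at hk
      have hmem : D.g ^ (i * k) * D.s ^ k ∈ Subgroup.zpowers D.g := by
        rw [hk]; exact D.c_mem_zpowers_g
      obtain ⟨m, rfl⟩ := D.even_of_pow_mul_spow_mem hmem
      rw [show m + m = 2 * m by ring, pow_mul D.s, pow_two, D.hs2, one_pow, mul_one,
        show i * (2 * m) = 2 * i * m by ring, pow_mul] at hk
      have h2 := Subgroup.pow_mem (Subgroup.zpowers (D.g ^ (2 * i))) (Subgroup.mem_zpowers _) m
      rwa [hk] at h2
    · intro h
      obtain ⟨m, -, hm⟩ := IndexTwoCyclic.exists_pow_eq_of_mem_zpowers h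
      have e : (D.g ^ i * D.s) ^ (2 * m) = D.g ^ (i * (2 * m)) := by
        rw [D.pow_mul_s_pow, pow_mul D.s, pow_two, D.hs2, one_pow, mul_one]
      have h2 := Subgroup.pow_mem (Subgroup.zpowers (D.g ^ i * D.s)) (Subgroup.mem_zpowers _) (2 * m)
      rw [e, show i * (2 * m) = 2 * i * m by ring, pow_mul, hm] at h2
      exact h2
  rw [key, D.c_mem_zpowers_pow_iff, show 2 * i = i * 2 by ring, pow_mul, orderOf_pow' _ two_ne_zero]
  -- `Even (d / gcd d 2) ↔ 4 ∣ d` for `d = ord gⁱ > 0`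
  set d := orderOf (D.g ^ i) with hd
  have hdpos : 0 < d := orderOf_pos _
  rcases Nat.even_or_odd d with ⟨k, hk⟩ | hodd
  · have hk2 : d = 2 * k := by omega
    rw [hk2, Nat.gcd_mul_right_left, Nat.mul_div_cancel_left _ two_pos]
    constructor
    · rintro ⟨j, rfl⟩; exact ⟨j, by ring⟩
    · rintro ⟨j, hj⟩; exact ⟨j, by omega⟩
  · have hg : Nat.gcd d 2 = 1 := Nat.Coprime.gcd_eq_one (Nat.coprime_two_right.mpr hodd)
    rw [hg, Nat.div_one]
    constructor
    · intro h; exact absurd hodd (Nat.not_odd_iff_even.mpr h)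
    · intro h; exfalso; exact hodd.not_two_dvd_nat (dvd_trans ⟨2, rfl⟩ h)

omit [DecidableEq G] in
/-- `gⁱ x ≠ 1` and `gⁱ x ≠ c` (it is not a rotation). [folklore] -/
theorem pow_mul_x_notMem_zpowers (i : ℕ) : D.g ^ i * D.x ∉ Subgroup.zpowers D.g := fun h => by
  have h' := Subgroup.mul_mem _ (Subgroup.inv_mem _ (Subgroup.pow_mem _ (Subgroup.mem_zpowers D.g) i)) h
  rw [inv_mul_cancel_left] at h'
  exact D.x_notMem_zpowers_g h'

omit [DecidableEq G] in
/-- **The involutions `gⁱ x`: `c ∉ ⟨gⁱ x⟩` and `ord (gⁱ x) = 2`.** [folklore] -/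
theorem c_notMem_zpowers_pow_mul_x (i : ℕ) : c ∉ Subgroup.zpowers (D.g ^ i * D.x) ∧ orderOf (D.g ^ i * D.x) = 2 := by
  have h1 : D.g ^ i * D.x ≠ 1 := fun h => D.pow_mul_x_notMem_zpowers i (h ▸ one_mem _)
  have hc : D.g ^ i * D.x ≠ c := fun h => D.pow_mul_x_notMem_zpowers i (by rw [h]; exact D.c_mem_zpowers_g)
  exact ⟨TypeStabiliser.notMem_zpowers_of_mul_self_eq_one c (D.pow_mul_x_mul_self i) D.c_ne_one hc,
    orderOf_eq_prime (by rw [pow_two]; exact D.pow_mul_x_mul_self i) h1⟩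

omit [Fintype G] [DecidableEq G] in
/-- **The elements `gⁱ s x` have `c` among their powers.** [folklore] -/
theorem c_mem_zpowers_pow_mul_s_mul_x (i : ℕ) : c ∈ Subgroup.zpowers (D.g ^ i * D.s * D.x) := by
  have h := Subgroup.pow_mem (Subgroup.zpowers (D.g ^ i * D.s * D.x)) (Subgroup.mem_zpowers _) 2
  rwa [pow_two, D.pow_mul_s_mul_x_mul_self i] at h

/-! ## §2 The block count -/

omit [DecidableEq G] in
/-- The Burnside term of an element. [folklore] -/
theorem burnsideTerm_eq (y : G) :
    (if c ∈ Subgroup.zpowers y then 0 else 2 ^ (Fintype.card G / orderOf y / 2)) =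
      (if c ∈ Subgroup.zpowers y then 0 else 2 ^ (4 * n / orderOf y)) := by
  split_ifs
  · rfl
  · rw [D.card_eq_eight_mul, Nat.div_div_eq_div_mul, show 8 * n = (4 * n) * 2 by ring, Nat.mul_div_mul_right _ _ two_pos]

omit [DecidableEq G] in
/-- The rotation term `τ_n(d) = [d odd]·2^{4n/d} + [4 ∤ d]·2^{4n/lcm(2,d)}` of the block count. [folklore] -/
theorem rotationTerm_eq (i : ℕ) :
    (if c ∈ Subgroup.zpowers (D.g ^ i) then 0 else 2 ^ (4 * n / orderOf (D.g ^ i))) +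
      (if c ∈ Subgroup.zpowers (D.g ^ i * D.s) then 0 else 2 ^ (4 * n / orderOf (D.g ^ i * D.s))) =
    (if Even (orderOf (D.g ^ i)) then 0 else 2 ^ (4 * n / orderOf (D.g ^ i))) +
      (if 4 ∣ orderOf (D.g ^ i) then 0 else 2 ^ (4 * n / Nat.lcm 2 (orderOf (D.g ^ i)))) := by
  simp only [D.c_mem_zpowers_pow_iff, D.c_mem_zpowers_pow_mul_s_iff, D.orderOf_pow_mul_s]

omit [DecidableEq G] in
/-- **Summing a function of the order over the rotations `gⁱ`, `i < 2n`, counts `φ(d)` rotations of each order `d ∣ 2n`.** [folklore] -/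
theorem sum_rotations_eq_sum_divisors (T : ℕ → ℕ) :
    ∑ i : Fin (2 * n), T (orderOf (D.g ^ (i : ℕ))) = ∑ d ∈ (2 * n).divisors, d.totient * T d := by
  classical
  have hfin : IsOfFinOrder D.g := isOfFinOrder_of_finite D.g
  -- reindex by `Fin (2n) ≃ Fin (orderOf g) ≃ zpowers g`
  have h1 : ∑ i : Fin (2 * n), T (orderOf (D.g ^ (i : ℕ))) = ∑ y : Subgroup.zpowers D.g, T (orderOf y) := by
    rw [← Equiv.sum_comp ((finCongr D.hord.symm).trans (finEquivZPowers hfin)) (fun y : Subgroup.zpowers D.g => T (orderOf y))]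
    refine Finset.sum_congr rfl fun i _ => ?_
    simp only [Equiv.trans_apply, finEquivZPowers_apply, finCongr_apply, Fin.val_cast, Subgroup.orderOf_mk]
  rw [h1]
  have hcard : Fintype.card (Subgroup.zpowers D.g) = 2 * n := by rw [Fintype.card_zpowers, D.hord]
  have hmaps : ∀ y ∈ (Finset.univ : Finset (Subgroup.zpowers D.g)), orderOf y ∈ (2 * n).divisors := fun y _ =>
    Nat.mem_divisors.mpr ⟨hcard ▸ orderOf_dvd_card, by have := D.n_ne_zero; omega⟩
  rw [← Finset.sum_fiberwise_of_maps_to' hmaps]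
  refine Finset.sum_congr rfl fun d hd => ?_
  rw [Finset.sum_const, smul_eq_mul, IsCyclic.card_orderOf_eq_totient (hcard ▸ Nat.dvd_of_mem_divisors hd)]

/-- **THE BLOCK COUNT `β(G_n) · 8n = Σ_{d ∣ 2n} φ(d)·([d odd]·2^{4n/d} + [4 ∤ d]·2^{4n/lcm(2,d)}) + 2n · 4ⁿ`.** [folklore] -/
theorem card_block_mul_eq_sum_divisors (hc2 : c * c = 1) :
    Fintype.card (Block c) * (8 * n) =
      (∑ d ∈ (2 * n).divisors, d.totient * ((if Even d then 0 else 2 ^ (4 * n / d)) + (if 4 ∣ d then 0 else 2 ^ (4 * n / Nat.lcm 2 d)))) +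
        2 * n * 4 ^ n := by
  classical
  have hB := card_block_mul_card c hc2 D.hcen
  rw [Finset.sum_congr rfl (fun y _ => D.burnsideTerm_eq y), D.card_eq_eight_mul] at hB
  rw [hB]
  -- reindex over the normal form
  obtain ⟨e, he⟩ : ∃ e : Fin (2 * n) × Fin 2 × Fin 2 ≃ G, ∀ t, e t = D.g ^ (t.1 : ℕ) * D.s ^ (t.2.1 : ℕ) * D.x ^ (t.2.2 : ℕ) := by
    let f : Fin (2 * n) × Fin 2 × Fin 2 → G := fun t => D.g ^ (t.1 : ℕ) * D.s ^ (t.2.1 : ℕ) * D.x ^ (t.2.2 : ℕ)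
    have hinj : Function.Injective f := by
      rintro ⟨i, j, e⟩ ⟨i', j', e'⟩ h
      obtain ⟨h1, h2, h3⟩ := D.normalForm_inj i.2 i'.2 j.2 j'.2 e.2 e'.2 h
      ext <;> simp only [h1, h2, h3]
    have hcard : Fintype.card (Fin (2 * n) × Fin 2 × Fin 2) = Fintype.card G := by
      rw [D.card_eq_eight_mul]; simp only [Fintype.card_prod, Fintype.card_fin]; ring
    exact ⟨Equiv.ofBijective f ((Fintype.bijective_iff_injective_and_card f).mpr ⟨hinj, hcard⟩), fun t => rfl⟩
  rw [← Equiv.sum_comp e, Fintype.sum_prod_type]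
  -- now: Σ_i Σ_{(j,e)} term(g^i s^j x^e)
  have hrow : ∀ i : Fin (2 * n), ∑ je : Fin 2 × Fin 2, (if c ∈ Subgroup.zpowers (e (i, je)) then 0 else 2 ^ (4 * n / orderOf (e (i, je)))) =
      ((if Even (orderOf (D.g ^ (i : ℕ))) then 0 else 2 ^ (4 * n / orderOf (D.g ^ (i : ℕ)))) +
        (if 4 ∣ orderOf (D.g ^ (i : ℕ)) then 0 else 2 ^ (4 * n / Nat.lcm 2 (orderOf (D.g ^ (i : ℕ)))))) + 4 ^ n := by
    intro i
    rw [Fintype.sum_prod_type]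
    simp only [Fin.sum_univ_two, he, Fin.val_zero, Fin.val_one, pow_zero, pow_one, mul_one]
    obtain ⟨hx1, hx2⟩ := D.c_notMem_zpowers_pow_mul_x i
    rw [if_neg hx1, hx2, if_pos (D.c_mem_zpowers_pow_mul_s_mul_x i), add_zero, ← D.rotationTerm_eq,
      show 4 * n / 2 = 2 * n by omega, pow_mul, show (2 : ℕ) ^ 2 = 4 by norm_num]
    ring
  have hrot := D.sum_rotations_eq_sum_divisors (fun d => (if Even d then 0 else 2 ^ (4 * n / d)) +
      (if 4 ∣ d then 0 else 2 ^ (4 * n / Nat.lcm 2 d)))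

  rw [Finset.sum_congr rfl (fun i _ => hrow i), Finset.sum_add_distrib, Finset.sum_const, Finset.card_univ, Fintype.card_fin,
    smul_eq_mul, hrot]

end Datum

/-! ## §3 Rows -/

namespace Datum

/-- **`n = 2` (the Pauli group `D₄ ∘ ℤ/4`, order 16): `β = 22`, `φ₂ = 20`** (`β·16 = (256 + 16) + 16 + 0 + 4·16 = 352`). [folklore] -/
theorem card_block_eq_twentyTwo (D : Datum G c 2) (hc2 : c * c = 1) : Fintype.card (Block c) = 22 ∧ fibreTwo c hc2 = 20 := by
  suffices hβ : Fintype.card (Block c) = 22 by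
    exact ⟨hβ, by have := D.card_block_eq_fibreTwo_add_two hc2; omega⟩
  have h := D.card_block_mul_eq_sum_divisors hc2
  have hdiv : Nat.divisors (2 * 2) = {1, 2, 4} := by decide
  have ht1 : Nat.totient 1 = 1 := Nat.totient_one
  have ht2 : Nat.totient 2 = 1 := by decide
  have ht4 : Nat.totient 4 = 2 := by decide
  rw [hdiv, Finset.sum_insert (by decide), Finset.sum_pair (by decide), ht1, ht2, ht4] at h
  norm_num [Nat.lcm] at h
  omega

/-- **`n = 3` (`X₃ = ℤ/3 ⋊ D₄` with Klein kernel, order 24): `β = 194`, `φ₂ = 192`** (`β·24 = 4160 + 64 + 40 + 8 + 6·64 = 4656`). [folklore] -/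
theorem card_block_eq_oneHundredNinetyFour (D : Datum G c 3) (hc2 : c * c = 1) :
    Fintype.card (Block c) = 194 ∧ fibreTwo c hc2 = 192 := by
  suffices hβ : Fintype.card (Block c) = 194 by
    exact ⟨hβ, by have := D.card_block_eq_fibreTwo_add_two hc2; omega⟩
  have h := D.card_block_mul_eq_sum_divisors hc2
  have hdiv : Nat.divisors (2 * 3) = {1, 2, 3, 6} := by decide
  have ht1 : Nat.totient 1 = 1 := Nat.totient_one
  have ht2 : Nat.totient 2 = 1 := by decide
  have ht3 : Nat.totient 3 = 2 := by decide
  have ht6 : Nat.totient 6 = 2 := by decide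
  rw [hdiv, Finset.sum_insert (by decide), Finset.sum_insert (by decide), Finset.sum_pair (by decide), ht1, ht2, ht3, ht6] at h
  norm_num [Nat.lcm] at h
  omega

/-- **`n = 4` (`(ℤ/8 × ℤ/2) ⋊ (−a+4b, b) = D(ℤ/8) ∘ ℤ/4`, order 32): `β = 2128`, `φ₂ = 2126`** (`β·32 = 66048 + 2048 = 68096`). [folklore] -/
theorem card_block_eq_2128 (D : Datum G c 4) (hc2 : c * c = 1) : Fintype.card (Block c) = 2128 ∧ fibreTwo c hc2 = 2126 := by
  suffices hβ : Fintype.card (Block c) = 2128 by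
    exact ⟨hβ, by have := D.card_block_eq_fibreTwo_add_two hc2; omega⟩
  have h := D.card_block_mul_eq_sum_divisors hc2
  have hdiv : Nat.divisors (2 * 4) = {1, 2, 4, 8} := by decide
  have ht1 : Nat.totient 1 = 1 := Nat.totient_one
  have ht2 : Nat.totient 2 = 1 := by decide
  have ht4 : Nat.totient 4 = 2 := by decide
  have ht8 : Nat.totient 8 = 4 := by decide
  rw [hdiv, Finset.sum_insert (by decide), Finset.sum_insert (by decide), Finset.sum_pair (by decide), ht1, ht2, ht4, ht8] at h
  norm_num [Nat.lcm] at h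
  omega

/-- **The floors in numbers**: every generating face family of `G_2`, `G_3`, `G_4` has at least `20`, `192`, `2126` members. [folklore] -/
theorem twenty_le_card (D : Datum G c 2) (hc2 : c * c = 1) (S : Finset (CMF G c →₀ ℤ)) (hSF : (S : Set (CMF G c →₀ ℤ)) ⊆ gfaceSet G c hc2)
    (hgen : hodgeSpan c hc2 ≤ Submodule.span ℤ (pairSet c) ⊔ Submodule.span ℤ (translates c S)) :
    20 ≤ S.card := by
  have h := D.card_block_le_card_add_two hc2 S hSF hgen
  rw [(card_block_eq_twentyTwo D hc2).1] at h
  omega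

/-- `n = 3`: at least `192` faces. [folklore] -/
theorem oneHundredNinetyTwo_le_card (D : Datum G c 3) (hc2 : c * c = 1) (S : Finset (CMF G c →₀ ℤ))
    (hSF : (S : Set (CMF G c →₀ ℤ)) ⊆ gfaceSet G c hc2)
    (hgen : hodgeSpan c hc2 ≤ Submodule.span ℤ (pairSet c) ⊔ Submodule.span ℤ (translates c S)) :
    192 ≤ S.card := by
  have h := D.card_block_le_card_add_two hc2 S hSF hgen
  rw [(card_block_eq_oneHundredNinetyFour D hc2).1] at h
  omega

/-- `n = 4`: at least `2126` faces. [folklore] -/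
theorem le_card_2126 (D : Datum G c 4) (hc2 : c * c = 1) (S : Finset (CMF G c →₀ ℤ))
    (hSF : (S : Set (CMF G c →₀ ℤ)) ⊆ gfaceSet G c hc2)
    (hgen : hodgeSpan c hc2 ≤ Submodule.span ℤ (pairSet c) ⊔ Submodule.span ℤ (translates c S)) :
    2126 ≤ S.card := by
  have h := D.card_block_le_card_add_two hc2 S hSF hgen
  rw [(card_block_eq_2128 D hc2).1] at h
  omega

end Datum

end

end Summit.HodgeConjecture.CorCM.Census.ShearedDihedral
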